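import Summits.KontsevichZagierPeriods.KontsevichZagierPeriods.Theorems.LinRedNormalFormArrangementNormalFormStubRebaseSimplePosOneFibreSplit
import Summits.KontsevichZagierPeriods.KontsevichZagierPeriods.Theorems.LinRedNormalFormArrangementNormalFormStubRebaseSimplePosOneFibreWedge

/-!
# Stub `stub_rebaseSimplePos`, part `rebaseSimplePos_oneFibre` (crux `ArrangementNormalForm`,
line `janus-bands`, v6.2) — sub-part `Reduce`

The CASE-TREE SKELETON of the one-fibre rebase over a base of dimension `B + 1 ≥ 1`
(`stub_rebaseOne`'s dissection with the silent coordinates `x'` carried along), on the literal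
class text, reducing the registered part `rebaseSimplePos_oneFibre`
(`GS (b+1) 1 → closure (GG (b+1) 2 1)`) to its analytic core: the hypothesis `hH` that every
one-fibre literal representation whose fibre is lettered with the letter `0`, whose two affine
bounds `u < v` are TRANSVERSE to the letter in `y` and lie strictly ABOVE it on the base cell, is
congruent to the subgroup generated by `GG B 2 1`. The reduction (all rules 1a / 2, uniformly in
`x'`): a mutual bound empties the domain; a letter-free fibre or a bound parallel to the letter is
the product case (`RebasePos.good_product`); otherwise shear the letter to `0`
(`RebasePos.pull`), cut the base cell by the signs of `u` and `v` (`RebasePos.cutBase`): above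
(`hH`), crossing (`RebasePos.good_levelSplit` at the level `0`), below (reflection `t ↦ −t`,
`RebasePos.pull` with `μ = −1`, then `hH`). Registered as `rebaseSimplePos_oneFibre_of_above`.
The hypothesis `hH` itself is closed only in sub-cases (`rebaseSimplePos_levelSplit`; the
dominated wedges of `rebaseSimplePos_wedgeNear`); see the module docstring of part `Wedge` for
the non-dominated residue.

References: M. Kontsevich, D. Zagier, *Periods* (2001), §1.2.
-/

noncomputable section

open Set MeasureTheory MvPolynomial
open Literature.NumberTheory.Transcendental Literature.ModelTheory.ExponentialFields

namespace Summit.KontsevichZagierPeriods.ArrangementNormalForm.JanusBands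

namespace RebasePos

open SeparatePos

section Reduce

variable {B m : ℕ}

/-- `affF` of a negated form. -/
theorem affF_neg' {K : ℕ} (h : (Fin (B + 1) → ℚ) × ℚ) (z : Fin (B + 1 + K) → ℝ) :
    affF B K (-h) z = -affF B K h z := by
  simp only [affF, Prod.fst_neg, Prod.snd_neg, Pi.neg_apply, Rat.cast_neg, neg_mul,
    Finset.sum_neg_distrib]
  ring

/-- `affF` of a difference of forms. -/
theorem affF_sub' {K : ℕ} (h h' : (Fin (B + 1) → ℚ) × ℚ) (z : Fin (B + 1 + K) → ℝ) :
    affF B K (h - h') z = affF B K h z - affF B K h' z := by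
  simp only [affF, Prod.fst_sub, Prod.snd_sub, Pi.sub_apply, Rat.cast_sub, sub_mul,
    Finset.sum_sub_distrib]
  ring

/-- `affF` of the zero form. -/
theorem affF_zero' {K : ℕ} (z : Fin (B + 1 + K) → ℝ) : affF B K (0 : (Fin (B + 1) → ℚ) × ℚ) z = 0 := by
  simp [affF]

/-- Shearing a form along itself kills it: `pullC 1 (c_y) (c|ₓ') c = 0`. -/
theorem pullC_self (c : (Fin (B + 1) → ℚ) × ℚ) : pullC 1 (c.1 (Fin.last B)) (restr B c) c = 0 := by
  refine Prod.ext (funext fun j => ?_) ?_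
  · refine Fin.lastCases ?_ (fun j => ?_) j
    · simp [pullC]
    · simp [pullC, restr]
  · simp [pullC, restr]

/-- The reflection `t ↦ −t` on forms: `pullC (−1) 0 0 c = −c`. -/
theorem pullC_reflect (c : (Fin (B + 1) → ℚ) × ℚ) : pullC (-1) 0 (0 : (Fin B → ℚ) × ℚ) c = -c := by
  refine Prod.ext (funext fun j => ?_) ?_
  · refine Fin.lastCases ?_ (fun j => ?_) j
    · simp [pullC, div_neg]
    · simp [pullC, div_neg]
  · simp [pullC, div_neg]

/-- A representation with empty (or null) domain is good. -/
theorem good_of_null {S : Set KZ.FormalRep} {n : ℕ} (s : KZ.IntegralRep n) (h : volume s.domain = 0) :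
    ∃ c ∈ AddSubgroup.closure S, KZ.of s - c ∈ KZ.relations :=
  ⟨0, zero_mem _, by simpa using KZ.of_mem_relations_of_volume_eq_zero s h⟩

variable (L : Fin m → (Fin B → ℚ) × ℚ) (e : Fin m → ℕ) (ℓ₁ ℓ₂ : (Fin B → ℚ) × ℚ) (n₁ n₂ : ℕ)

/-- **Below the letter: reflection.** A one-fibre band with letter `0` lying BELOW the letter
(`u < v < 0` on the base cell, transverse bounds) is good if bands above the letter are (`hH`):
reflect `t ↦ −t` (rule 2, `pull` with `μ = −1`). -/
theorem good_below {m' : ℕ} (s : KZ.IntegralRep (B + 1 + 1)) (M : Fin m' → (Fin (B + 1) → ℚ) × ℚ)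
    (p : MvPolynomial (Fin B) ℚ) (u v : (Fin (B + 1) → ℚ) × ℚ) (hbd : Bornology.IsBounded s.domain)
    (hdom : s.domain = gDom B 1 m' M (fun _ => Sum.inr u) (fun _ => Sum.inr v))
    (hint : EqOn s.integrand (glit B 1 p L e ℓ₁ ℓ₂ n₁ n₂ (fun _ => some 0)) s.domain)
    (hu : u.1 (Fin.last B) ≠ 0) (hv : v.1 (Fin.last B) ≠ 0)
    (hcell : ∀ z : Fin (B + 1 + 1) → ℝ, (∀ j, 0 < affF B 1 (M j) z) →
      affF B 1 u z < affF B 1 v z ∧ affF B 1 v z < 0)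
    (hH : ∀ (m' : ℕ) (s : KZ.IntegralRep (B + 1 + 1)) (M : Fin m' → (Fin (B + 1) → ℚ) × ℚ)
      (p : MvPolynomial (Fin B) ℚ) (u v : (Fin (B + 1) → ℚ) × ℚ), Bornology.IsBounded s.domain →
      s.domain = gDom B 1 m' M (fun _ => Sum.inr u) (fun _ => Sum.inr v) →
      EqOn s.integrand (glit B 1 p L e ℓ₁ ℓ₂ n₁ n₂ (fun _ => some 0)) s.domain →
      u.1 (Fin.last B) ≠ 0 → v.1 (Fin.last B) ≠ 0 →
      (∀ z : Fin (B + 1 + 1) → ℝ, (∀ j, 0 < affF B 1 (M j) z) → 0 < affF B 1 u z ∧ affF B 1 u z < affF B 1 v z) →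
      ∃ c ∈ AddSubgroup.closure (GGset B 2 1), KZ.of s - c ∈ KZ.relations) :
    ∃ c ∈ AddSubgroup.closure (GGset B 2 1), KZ.of s - c ∈ KZ.relations := by
  obtain ⟨s', -, hbd', hdom', hint', hrel⟩ := pull (fun _ : Fin 1 => (-1 : ℚ)) (fun _ => (0 : ℚ))
    (fun _ => (0 : (Fin B → ℚ) × ℚ)) s M L e p ℓ₁ ℓ₂ n₁ n₂ (fun _ => some 0) (fun _ => Sum.inr u)
    (fun _ => Sum.inr v) hbd hdom hint (fun _ => by norm_num) (fun i j hij => by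
      rcases hij with h | h <;> cases h)
  suffices hs' : ∃ c ∈ AddSubgroup.closure (GGset B 2 1), KZ.of s' - c ∈ KZ.relations by
    obtain ⟨c₀, hc₀, hc₀'⟩ := hs'
    exact ⟨c₀, hc₀, by have := add_mem hrel hc₀'; rwa [sub_add_sub_cancel] at this⟩
  refine hH m' s' M (MvPolynomial.C (pullQ (fun _ : Fin 1 => (-1 : ℚ))
    (fun _ => some (0 : (Fin (B + 1) → ℚ) × ℚ))) * p) (-v) (-u) hbd' ?_ ?_ ?_ ?_ fun z hz => ?_
  · have hneg : ¬ ((0 : ℚ) < -1) := by norm_num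
    rw [hdom']
    congr 1 <;> funext i <;> simp [pullLo, pullHi, hneg, pullC_reflect]
  · convert hint' using 2
    funext i
    simp [pullA, pullC_reflect]
  · simpa using hv
  · simpa using hu
  · obtain ⟨h1, h2⟩ := hcell z hz
    rw [affF_neg', affF_neg']
    exact ⟨by linarith, by linarith⟩

/-- Pulled forms under a pure shear (`μ = 1`). -/
theorem affF_pullC_one (α : ℚ) (δ : (Fin B → ℚ) × ℚ) (u : (Fin (B + 1) → ℚ) × ℚ)
    (z : Fin (B + 1 + 1) → ℝ) : affF B 1 (pullC 1 α δ u) z =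
      affF B 1 u z - ((α : ℝ) * z (Fin.castAdd 1 (Fin.last B)) + affB B 1 δ z) := by
  have h := pullInv_fib_sub_affF (fun _ : Fin 1 => (1 : ℚ)) (fun _ => α) (fun _ => δ)
    (fun _ => one_ne_zero) 0 u z
  simp only [pullInv_fib, Rat.cast_one, one_mul] at h
  linarith

/-- Rows of an extended row family. -/
theorem rows_snoc {m' : ℕ} {M : Fin m' → (Fin (B + 1) → ℚ) × ℚ} {h : (Fin (B + 1) → ℚ) × ℚ}
    {z : Fin (B + 1 + 1) → ℝ} (hz : ∀ j, 0 < affF B 1 ((Fin.snoc M h : Fin (m' + 1) → _) j) z) :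
    (∀ j, 0 < affF B 1 (M j) z) ∧ 0 < affF B 1 h z :=
  ⟨fun j => by simpa using hz (Fin.castSucc j), by simpa using hz (Fin.last m')⟩

/-- A form with non-zero `y`-coefficient is non-zero. -/
theorem ne_zero_of_last {u : (Fin (B + 1) → ℚ) × ℚ} (hu : u.1 (Fin.last B) ≠ 0) : u ≠ 0 :=
  fun h => hu (by simp [h])

/-- **Letter `0`, transverse bounds: dissection by the signs of the bounds.** Cut the base cell
by the sign of `u` and of `v` (rule 1a): above the letter (`hH`), crossing (level split at `0`),
below (reflection). -/
theorem good_letterZero {m' : ℕ} (s : KZ.IntegralRep (B + 1 + 1)) (M : Fin m' → (Fin (B + 1) → ℚ) × ℚ)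
    (p : MvPolynomial (Fin B) ℚ) (u v : (Fin (B + 1) → ℚ) × ℚ) (h12 : n₁ = 0 ∨ n₂ = 0)
    (hbd : Bornology.IsBounded s.domain)
    (hdom : s.domain = gDom B 1 m' M (fun _ => Sum.inr u) (fun _ => Sum.inr v))
    (hint : EqOn s.integrand (glit B 1 p L e ℓ₁ ℓ₂ n₁ n₂ (fun _ => some 0)) s.domain)
    (hu : u.1 (Fin.last B) ≠ 0) (hv : v.1 (Fin.last B) ≠ 0)
    (huv : ∀ z : Fin (B + 1 + 1) → ℝ, (∀ j, 0 < affF B 1 (M j) z) → affF B 1 u z < affF B 1 v z)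
    (hH : ∀ (m' : ℕ) (s : KZ.IntegralRep (B + 1 + 1)) (M : Fin m' → (Fin (B + 1) → ℚ) × ℚ)
      (p : MvPolynomial (Fin B) ℚ) (u v : (Fin (B + 1) → ℚ) × ℚ), Bornology.IsBounded s.domain →
      s.domain = gDom B 1 m' M (fun _ => Sum.inr u) (fun _ => Sum.inr v) →
      EqOn s.integrand (glit B 1 p L e ℓ₁ ℓ₂ n₁ n₂ (fun _ => some 0)) s.domain →
      u.1 (Fin.last B) ≠ 0 → v.1 (Fin.last B) ≠ 0 →
      (∀ z : Fin (B + 1 + 1) → ℝ, (∀ j, 0 < affF B 1 (M j) z) → 0 < affF B 1 u z ∧ affF B 1 u z < affF B 1 v z) →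
      ∃ c ∈ AddSubgroup.closure (GGset B 2 1), KZ.of s - c ∈ KZ.relations) :
    ∃ c ∈ AddSubgroup.closure (GGset B 2 1), KZ.of s - c ∈ KZ.relations := by
  obtain ⟨s₁, s₂, hm₁, hm₂, hi₁, hi₂, hd₁, hd₂, hrel⟩ := cutBase s M _ _ hdom u (ne_zero_of_last hu)
  have hsub₁ : s₁.domain ⊆ s.domain := fun z hz => ((hm₁ z).1 hz).1
  have hsub₂ : s₂.domain ⊆ s.domain := fun z hz => ((hm₂ z).1 hz).1
  refine good_of_split hrel ?_ ?_
  · -- above the letter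
    exact hH (m' + 1) s₁ (Fin.snoc M u) p u v (hbd.subset hsub₁) hd₁
      (by rw [hi₁]; exact hint.mono hsub₁) hu hv fun z hz =>
        ⟨(rows_snoc hz).2, huv z (rows_snoc hz).1⟩
  · obtain ⟨s₃, s₄, hm₃, hm₄, hi₃, hi₄, hd₃, hd₄, hrel'⟩ :=
      cutBase s₂ (Fin.snoc M (-u)) _ _ hd₂ v (ne_zero_of_last hv)
    have hsub₃ : s₃.domain ⊆ s.domain := fun z hz => hsub₂ ((hm₃ z).1 hz).1
    have hsub₄ : s₄.domain ⊆ s.domain := fun z hz => hsub₂ ((hm₄ z).1 hz).1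
    refine good_of_split hrel' ?_ ?_
    · -- crossing the letter: split at the level `0`
      refine good_levelSplit (fun _ => some 0) (fun _ => u) (fun _ => v) s₃ _ L e p ℓ₁ ℓ₂
        (fun _ => Sum.inr u) (fun _ => Sum.inr v) h12 (hbd.subset hsub₃) hd₃
        (by rw [hi₃, hi₂]; exact hint.mono hsub₃) (fun _ => rfl) (fun _ => rfl) 0 0
        (fun i c hi _ => absurd (Subsingleton.elim i 0) hi) (fun c hc => by cases hc; rfl)
        fun z hz => ?_
      obtain ⟨hz', hvz⟩ := rows_snoc hz
      obtain ⟨-, huz⟩ := rows_snoc hz'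
      rw [affF_neg'] at huz
      rw [affF_zero']
      exact ⟨by linarith, hvz.le⟩
    · -- below the letter: reflect
      refine good_below L e ℓ₁ ℓ₂ n₁ n₂ s₄ _ p u v (hbd.subset hsub₄) hd₄
        (by rw [hi₄, hi₂]; exact hint.mono hsub₄) hu hv (fun z hz => ?_) hH
      obtain ⟨hz', hvz⟩ := rows_snoc hz
      obtain ⟨hz'', -⟩ := rows_snoc hz'
      rw [affF_neg'] at hvz
      exact ⟨huv z hz'', by linarith⟩

/-- **A transverse letter: shear it to `0`** (rule 2, `pull` with `μ = 1`, `α` the letter's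
`y`-slope, `δ` its `x'`-part), then `good_letterZero`. -/
theorem good_lettered {m' : ℕ} (s : KZ.IntegralRep (B + 1 + 1)) (M : Fin m' → (Fin (B + 1) → ℚ) × ℚ)
    (p : MvPolynomial (Fin B) ℚ) (c u v : (Fin (B + 1) → ℚ) × ℚ) (h12 : n₁ = 0 ∨ n₂ = 0)
    (hbd : Bornology.IsBounded s.domain)
    (hdom : s.domain = gDom B 1 m' M (fun _ => Sum.inr u) (fun _ => Sum.inr v))
    (hint : EqOn s.integrand (glit B 1 p L e ℓ₁ ℓ₂ n₁ n₂ (fun _ => some c)) s.domain)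
    (hu : u.1 (Fin.last B) ≠ c.1 (Fin.last B)) (hv : v.1 (Fin.last B) ≠ c.1 (Fin.last B))
    (huv : ∀ z : Fin (B + 1 + 1) → ℝ, (∀ j, 0 < affF B 1 (M j) z) → affF B 1 u z < affF B 1 v z)
    (hH : ∀ (m' : ℕ) (s : KZ.IntegralRep (B + 1 + 1)) (M : Fin m' → (Fin (B + 1) → ℚ) × ℚ)
      (p : MvPolynomial (Fin B) ℚ) (u v : (Fin (B + 1) → ℚ) × ℚ), Bornology.IsBounded s.domain →
      s.domain = gDom B 1 m' M (fun _ => Sum.inr u) (fun _ => Sum.inr v) →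
      EqOn s.integrand (glit B 1 p L e ℓ₁ ℓ₂ n₁ n₂ (fun _ => some 0)) s.domain →
      u.1 (Fin.last B) ≠ 0 → v.1 (Fin.last B) ≠ 0 →
      (∀ z : Fin (B + 1 + 1) → ℝ, (∀ j, 0 < affF B 1 (M j) z) → 0 < affF B 1 u z ∧ affF B 1 u z < affF B 1 v z) →
      ∃ c ∈ AddSubgroup.closure (GGset B 2 1), KZ.of s - c ∈ KZ.relations) :
    ∃ c ∈ AddSubgroup.closure (GGset B 2 1), KZ.of s - c ∈ KZ.relations := by
  set α : ℚ := c.1 (Fin.last B) with hα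
  set δ : (Fin B → ℚ) × ℚ := restr B c with hδ
  obtain ⟨s', -, hbd', hdom', hint', hrel⟩ := pull (fun _ : Fin 1 => (1 : ℚ)) (fun _ => α)
    (fun _ => δ) s M L e p ℓ₁ ℓ₂ n₁ n₂ (fun _ => some c) (fun _ => Sum.inr u)
    (fun _ => Sum.inr v) hbd hdom hint (fun _ => one_ne_zero) (fun i j hij => by
      rcases hij with h | h <;> cases h)
  suffices hs' : ∃ c ∈ AddSubgroup.closure (GGset B 2 1), KZ.of s' - c ∈ KZ.relations by
    obtain ⟨c₀, hc₀, hc₀'⟩ := hs'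
    exact ⟨c₀, hc₀, by have := add_mem hrel hc₀'; rwa [sub_add_sub_cancel] at this⟩
  refine good_letterZero L e ℓ₁ ℓ₂ n₁ n₂ s' M
    (MvPolynomial.C (pullQ (fun _ : Fin 1 => (1 : ℚ)) (fun _ => some c)) * p)
    (pullC 1 α δ u) (pullC 1 α δ v) h12 hbd' ?_ ?_ ?_ ?_ (fun z hz => ?_) hH
  · rw [hdom']
    congr 1
  · convert hint' using 2
    funext i
    simp [pullA, hα, hδ, pullC_self]
  · rw [pullC_fst_last, div_one]; exact sub_ne_zero.2 hu
  · rw [pullC_fst_last, div_one]; exact sub_ne_zero.2 hv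
  · rw [affF_pullC_one, affF_pullC_one]
    linarith [huv z hz]

/-- **The one-fibre rebase, reduced to bands above the letter.** Any literal one-fibre datum
(`GG B σ 1` text, exponents `n₁ n₂` with `n₁ = 0 ∨ n₂ = 0`) is congruent to the subgroup
generated by `GG B 2 1`, provided lettered bands above the letter `0` with transverse bounds are
(`hH`). -/
theorem good_oneFibre {m' : ℕ} (s : KZ.IntegralRep (B + 1 + 1)) (M : Fin m' → (Fin (B + 1) → ℚ) × ℚ)
    (p : MvPolynomial (Fin B) ℚ) (a : Fin 1 → Option ((Fin (B + 1) → ℚ) × ℚ))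
    (lo hi : Fin 1 → Fin 1 ⊕ ((Fin (B + 1) → ℚ) × ℚ)) (h12 : n₁ = 0 ∨ n₂ = 0)
    (hbd : Bornology.IsBounded s.domain) (hdom : s.domain = gDom B 1 m' M lo hi)
    (hint : EqOn s.integrand (glit B 1 p L e ℓ₁ ℓ₂ n₁ n₂ a) s.domain)
    (hH : ∀ (m' : ℕ) (s : KZ.IntegralRep (B + 1 + 1)) (M : Fin m' → (Fin (B + 1) → ℚ) × ℚ)
      (p : MvPolynomial (Fin B) ℚ) (u v : (Fin (B + 1) → ℚ) × ℚ), Bornology.IsBounded s.domain →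
      s.domain = gDom B 1 m' M (fun _ => Sum.inr u) (fun _ => Sum.inr v) →
      EqOn s.integrand (glit B 1 p L e ℓ₁ ℓ₂ n₁ n₂ (fun _ => some 0)) s.domain →
      u.1 (Fin.last B) ≠ 0 → v.1 (Fin.last B) ≠ 0 →
      (∀ z : Fin (B + 1 + 1) → ℝ, (∀ j, 0 < affF B 1 (M j) z) → 0 < affF B 1 u z ∧ affF B 1 u z < affF B 1 v z) →
      ∃ c ∈ AddSubgroup.closure (GGset B 2 1), KZ.of s - c ∈ KZ.relations) :
    ∃ c ∈ AddSubgroup.closure (GGset B 2 1), KZ.of s - c ∈ KZ.relations := by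
  -- a mutual bound of the single fibre empties the domain
  rcases hlo : lo 0 with j | u
  · refine good_of_null s ?_
    have he : s.domain = ∅ := by
      rw [hdom]
      exact Set.eq_empty_iff_forall_notMem.2 fun z hz => by
        have h := (hz.2 0).1
        rw [hlo, Subsingleton.elim j 0] at h
        exact lt_irrefl _ h
    rw [he, measure_empty]
  rcases hhi : hi 0 with j | v
  · refine good_of_null s ?_
    have he : s.domain = ∅ := by
      rw [hdom]
      exact Set.eq_empty_iff_forall_notMem.2 fun z hz => by
        have h := (hz.2 0).2
        rw [hhi, Subsingleton.elim j 0] at h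
        exact lt_irrefl _ h
    rw [he, measure_empty]
  have hlo' : lo = fun _ => Sum.inr u := funext fun i => by rw [Subsingleton.elim i 0, hlo]
  have hhi' : hi = fun _ => Sum.inr v := funext fun i => by rw [Subsingleton.elim i 0, hhi]
  have ha' : a = fun _ => a 0 := funext fun i => by rw [Subsingleton.elim i 0]
  rw [hlo', hhi'] at hdom
  rw [ha'] at hint
  -- the row `v − u > 0`
  by_cases huv0 : v - u = 0
  · obtain rfl : v = u := sub_eq_zero.1 huv0
    refine good_of_null s ?_
    have he : s.domain = ∅ := by
      rw [hdom]
      exact Set.eq_empty_iff_forall_notMem.2 fun z hz => by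
        rw [mem_gDom_one] at hz
        exact lt_asymm hz.2.1 hz.2.2
    rw [he, measure_empty]
  obtain ⟨s₁, s₂, hm₁, hm₂, hi₁, -, hd₁, -, hrel⟩ := cutBase s M _ _ hdom (v - u) huv0
  have hsub₁ : s₁.domain ⊆ s.domain := fun z hz => ((hm₁ z).1 hz).1
  refine good_of_split hrel ?_ (good_of_null s₂ ?_)
  swap
  · refine measure_mono_null (fun z hz => ?_) (measure_empty (μ := (volume : Measure (Fin (B + 1 + 1) → ℝ))))
    obtain ⟨hzD, hneg⟩ := (hm₂ z).1 hz
    rw [hdom, mem_gDom_one] at hzD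
    rw [affF_sub'] at hneg
    exact absurd (lt_trans hzD.2.1 hzD.2.2) (by linarith)
  have huv : ∀ z : Fin (B + 1 + 1) → ℝ, (∀ j, 0 < affF B 1 ((Fin.snoc M (v - u) : Fin (m' + 1) → _) j) z) →
      affF B 1 u z < affF B 1 v z := fun z hz => by
    have h := (rows_snoc hz).2
    rw [affF_sub'] at h
    linarith
  have hbd₁ : Bornology.IsBounded s₁.domain := hbd.subset hsub₁
  have hint₁ : EqOn s₁.integrand (glit B 1 p L e ℓ₁ ℓ₂ n₁ n₂ (fun _ => a 0)) s₁.domain := by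
    rw [hi₁]; exact hint.mono hsub₁
  -- letter-free fibre, or a bound parallel to the letter: product case
  have hprod : (∀ c, a 0 = some c → u.1 (Fin.last B) = c.1 (Fin.last B) ∨
      v.1 (Fin.last B) = c.1 (Fin.last B)) →
      ∃ c ∈ AddSubgroup.closure (GGset B 2 1), KZ.of s₁ - c ∈ KZ.relations := fun hpar =>
    good_product (fun _ => a 0) (fun _ => u) (fun _ => v) s₁ _ L e p ℓ₁ ℓ₂ (fun _ => Sum.inr u)
      (fun _ => Sum.inr v) h12 hbd₁ hd₁ hint₁ (fun _ => rfl) (fun _ => rfl) fun _ c hc => hpar c hc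
  rcases ha0 : a 0 with _ | c
  · exact hprod fun c hc => by rw [ha0] at hc; cases hc
  by_cases hu : u.1 (Fin.last B) = c.1 (Fin.last B)
  · exact hprod fun c' hc' => by rw [ha0] at hc'; cases hc'; exact Or.inl hu
  by_cases hv : v.1 (Fin.last B) = c.1 (Fin.last B)
  · exact hprod fun c' hc' => by rw [ha0] at hc'; cases hc'; exact Or.inr hv
  rw [ha0] at hint₁
  exact good_lettered L e ℓ₁ ℓ₂ n₁ n₂ s₁ _ p c u v h12 hbd₁ hd₁ hint₁ hu hv huv hH

end Reduce

end RebasePos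

/-- **Registered part of `stub_rebaseSimplePos` / `rebaseSimplePos_oneFibre` (line `janus-bands`,
v6.2): the one-fibre rebase reduced to lettered bands above the letter.** For literal one-fibre
data over a base of dimension `B + 1` (any bounds, any letter, exponents `n₁ n₂` with
`n₁ = 0 ∨ n₂ = 0`): IF every one-fibre literal representation with the same `L e ℓ₁ ℓ₂ n₁ n₂`,
letter `0`, affine bounds `u < v` transverse to the letter in `y` and strictly above it on the
base cell is congruent modulo `KZ.relations` to the subgroup generated by the literal class
`GG B 2 1` (`hH`), THEN so is `[s]` (`RebasePos.good_oneFibre`: empty mutual bounds, product case,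
shear of the letter to `0`, base cuts by the signs of `u` and `v`, level split at `0` for a
crossing letter, reflection `t ↦ −t` below the letter; rules 1a and 2, uniformly in `x'`).
With `n₁ = 0`, `n₂ = 1` this reduces the registered part `rebaseSimplePos_oneFibre`
(`GS (b+1) 1`) to `hH`. -/
theorem rebaseSimplePos_oneFibre_of_above (B m m' n₁ n₂ : ℕ) (s : KZ.IntegralRep (B + 1 + 1)) (M : Fin m' → (Fin (B + 1) → ℚ) × ℚ) (L : Fin m → (Fin B → ℚ) × ℚ) (e : Fin m → ℕ) (p : MvPolynomial (Fin B) ℚ) (ℓ₁ ℓ₂ : (Fin B → ℚ) × ℚ) (a : Fin 1 → Option ((Fin (B + 1) → ℚ) × ℚ)) (lo hi : Fin 1 → Fin 1 ⊕ ((Fin (B + 1) → ℚ) × ℚ)) (h12 : n₁ = 0 ∨ n₂ = 0) (hbd : Bornology.IsBounded s.domain) (hdom : s.domain = SeparatePos.gDom B 1 m' M lo hi) (hint : EqOn s.integrand (RebasePos.glit B 1 p L e ℓ₁ ℓ₂ n₁ n₂ a) s.domain) (hH : ∀ (m' : ℕ) (s : KZ.IntegralRep (B + 1 + 1)) (M :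 Fin m' → (Fin (B + 1) → ℚ) × ℚ) (p : MvPolynomial (Fin B) ℚ) (c u v : (Fin (B + 1) → ℚ) × ℚ), c = 0 → Bornology.IsBounded s.domain → s.domain = SeparatePos.gDom B 1 m' M (fun _ => Sum.inr u) (fun _ => Sum.inr v) → EqOn s.integrand (RebasePos.glit B 1 p L e ℓ₁ ℓ₂ n₁ n₂ (fun _ => some c)) s.domain → u.1 (Fin.last B) ≠ 0 → v.1 (Fin.last B) ≠ 0 → (∀ z : Fin (B + 1 + 1) → ℝ, (∀ j, 0 < SeparatePos.affF B 1 (M j) z) → 0 < SeparatePos.affF B 1 u z ∧ SeparatePos.affF B 1 u z < SeparatePos.affF B 1 v z) → ∃ c' ∈ AddSubgroup.closure (SeparatePos.GGset B 2 1), KZ.of s - c' ∈ KZ.relations) : ∃ c ∈ AddSubgroup.closure (SeparatePos.GGset B 2 1), KZ.of s - c ∈ KZ.relations :=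
  RebasePos.good_oneFibre L e ℓ₁ ℓ₂ n₁ n₂ s M p a lo hi h12 hbd hdom hint
    fun m' s M p u v hbd hdom hint hu hv hcell => hH m' s M p 0 u v rfl hbd hdom hint hu hv hcell


end Summit.KontsevichZagierPeriods.ArrangementNormalForm.JanusBands
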